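import Summits.BirchSwinnertonDyer.BirchSwinnertonDyer.Theorems.ManinLocalTwoThreeShimuraIndexSquareBound
import Literature.NumberTheory.EllipticCurves.ManinConstantGamma1Gamma0Comparison
import HarnessLib

/-!
# THE EXPONENT OF THE SHIMURA QUOTIENT IS THE LEAST `X₀(N)`-MULTIPLIER OF STEVENS' CURVE: `{m : mc₁Λ₀(f) ⊆ Λ_{E₁}} = exp(Λ₀(f)/Λ₁(f))·ℤ`
# for an optimal `X₁(N)`-datum, fact-free; and `exp ∣ [Λ₀ : Λ₁] ∣ exp²` for every newform lattice

Summit `BirchSwinnertonDyer`, route `ManinLocalTwoThree` (cell bsd-f2-manin), crux C2 `ManinOddAtFour` (stmt-BirchSwinnertonDyer-22967; the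
statements are level-uniform and bear equally on C3, stmt-BirchSwinnertonDyer-22968).  Planner seat bsd-f2-manin-es (LENS es: the Shimura covering
`X₁(N) → X₀(N)` on period lattices), gen 46; TURNKEY T-es-117 for the C2/C3 LEAD.  In-tree imports only; independent of T-es-112…116.

THE OBJECT.  For a weight-`2` cusp form `f` on `Γ₀(N)` let `Q(f) := Λ₀(f)/Λ₁(f)` (`periodLattice f ⧸ (periodLatticeGamma1 f).addSubgroupOf _`),
a finite abelian group (`relIndex_ne_zero`, T-es-108), and `e(f) := exp Q(f)` its exponent (`AddMonoid.exponent`).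

§1 (pure lattice, every `f`).  `e(f)·Λ₀(f) ⊆ Λ₁(f)` (`exponent_mul_mem_periodLatticeGamma1`); `0 < e(f)` (`shimuraExponent_pos`); `e(f) ∣ [Λ₀(f) : Λ₁(f)]`
(Lagrange); and for the newform of an `X₀(N)`-parametrised curve `[Λ₀(f) : Λ₁(f)] ∣ e(f)²` (T-es-111's square bound at `m = e(f)`: `Λ₀(f)` has
rank `≤ 2`), so `e(f)` and the index have the same prime support; `mΛ₀ ⊆ Λ₁ ⟺ e(f) ∣ m` (`natMul_mem_iff_exponent_dvd`).
§2 (Stevens' curve, NO facts).  For an `X₁(N)`-datum `D₁` of any model `W` (constant `c₁`, `c₁Λ₁(f) ⊆ Λ_W`): `e(f)·c₁` is an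
`X₀(N)`-MULTIPLIER of `W` — `(e(f)c₁)·Λ₀(f) ⊆ Λ_W` (`exponent_mul_maninConstant₁_mul_mem_lattice`).  If `D₁` is OPTIMAL (`Λ_W = c₁Λ₁(f)`,
Stevens' curve `E₁`) then conversely every integer `m` with `(mc₁)·Λ₀(f) ⊆ Λ_W` is a multiple of `e(f)`
(`exponent_dvd_of_mul_maninConstant₁_mul_mem_lattice`), i.e. **`(mc₁)Λ₀(f) ⊆ Λ_{E₁} ⟺ e(f) ∣ m`** (`mul_maninConstant₁_mul_mem_lattice_iff_exponent_dvd`)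
and **`e(f)` is the LEAST positive `m` with `(mc₁)Λ₀(f) ⊆ Λ_{E₁}`** (`isLeast_exponent_mul_maninConstant₁`).  READING (with Stevens' `|c₁| = 1`, or
with T-es-116's derivation of it from Cremona's table): the least `X₀(N)`-Manin multiplier of Stevens' curve — «Cremona's constant of `E₁`» in the
cell's tables (desc §65 `c_k`, ref1 §R283 «c(E_St) = exp(Λ₀/Λ₁)») — IS the exponent of the Shimura quotient, and under the cyclicity facts
(`shimuraKernelCyclic_of_facts`) the index itself: `11a3 ↦ 5`, `15a8/17a4 ↦ 4`, the 73 index-2 classes of E15 `↦ 2`, the 23 index-3 `↦ 3`.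
§3 (with an `X₀(N)`-datum on the same curve).  Not repeated here: `e(f)·c₁ ∣ c` for every `X₀(N)`-datum of Stevens' curve is T-es-114
(`exponent_mul_maninConstant₁_dvd_maninConstant_sameCurve`); this file supplies the attainment half and the exact multiplier set.

HONEST FRAMING.  Elementary group theory (exponent of a finite quotient of `ℤ²`) on Stevens 1989 §2; printed mathematics, new formal proof in the
`relIndex` currency of T-es-107…116.  No definitions, no sorry, no fact binders.  C2, C3, Manin's conjecture and BSD are NOT proved by this file.
[cite: Stevens1989, §2 and Thm. 1.6] [cite: LingOesterle1991, §1 and Thm. 6] [cite: CesnaviciusNeururerSaha2023, §1 and Lemma 6.5]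
[cite: Cremona1997, §2.10] [cite: AgasheRibetStein2006, §2]
-/

set_option autoImplicit false
-- the summit-side namespace `Summit.BirchSwinnertonDyer.BirchSwinnertonDyer.…` is the tree's (summit = sub-problem)
set_option linter.dupNamespace false

noncomputable section

open scoped Classical MatrixGroups

open CongruenceSubgroup Matrix.SpecialLinearGroup ModularGroup
open Literature.NumberTheory.EllipticCurves Literature.NumberTheory.EllipticCurves.ModularForms

namespace Summit.BirchSwinnertonDyer.BirchSwinnertonDyer.Theorems.ManinLocalTwoThree.ShimuraIndex

section StevensMultipliers

variable {N : ℕ} [NeZero N]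

/-! ## §1 The exponent of `Λ₀(f)/Λ₁(f)` -/

omit [NeZero N] in
/-- Auxiliary step for the Stevens multipliers (membership in `Λ₁` of an integer multiple). [folklore] -/
private theorem natAbs_mul_mem_gamma1_aux (f : CuspForm (Gamma0 N) 2) {t : ℤ} {z : ℂ}
    (h : (t : ℂ) * z ∈ periodLatticeGamma1 f) : (t.natAbs : ℂ) * z ∈ periodLatticeGamma1 f := by
  rcases Int.natAbs_eq t with h' | h'
  · rw [h'] at h
    simpa only [Int.cast_natCast] using h
  · rw [h'] at h
    simp only [Int.cast_neg, Int.cast_natCast, neg_mul] at h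
    exact neg_mem_iff.mp h

omit [NeZero N] in
/-- **`exp(Λ₀(f)/Λ₁(f)) · Λ₀(f) ⊆ Λ₁(f)`**: the exponent kills the Shimura quotient. [cite: LingOesterle1991, §1] -/
theorem exponent_mul_mem_periodLatticeGamma1 (f : CuspForm (Gamma0 N) 2) {w : ℂ} (hw : w ∈ periodLattice f) :
    (AddMonoid.exponent (periodLattice f ⧸ (periodLatticeGamma1 f).addSubgroupOf (periodLattice f)) : ℂ) * w ∈
      periodLatticeGamma1 f := by
  have h : AddMonoid.exponent (periodLattice f ⧸ (periodLatticeGamma1 f).addSubgroupOf (periodLattice f)) •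
      (QuotientAddGroup.mk ⟨w, hw⟩ : periodLattice f ⧸ (periodLatticeGamma1 f).addSubgroupOf (periodLattice f)) = 0 :=
    AddMonoid.exponent_nsmul_eq_zero _
  rw [← QuotientAddGroup.mk_nsmul, QuotientAddGroup.eq_zero_iff, AddSubgroup.mem_addSubgroupOf] at h
  simpa only [AddSubgroupClass.coe_nsmul, nsmul_eq_mul] using h

omit [NeZero N] in
/-- `mΛ₀(f) ⊆ Λ₁(f)` ⟹ `exp(Λ₀(f)/Λ₁(f)) ∣ m` (the exponent divides every annihilator). [cite: LingOesterle1991, §1] -/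
theorem exponent_dvd_of_natMul_mem (f : CuspForm (Gamma0 N) 2) {m : ℕ}
    (hm : ∀ w ∈ periodLattice f, (m : ℂ) * w ∈ periodLatticeGamma1 f) :
    AddMonoid.exponent (periodLattice f ⧸ (periodLatticeGamma1 f).addSubgroupOf (periodLattice f)) ∣ m := by
  refine AddMonoid.exponent_dvd_of_forall_nsmul_eq_zero fun q ↦ ?_
  obtain ⟨x, rfl⟩ := QuotientAddGroup.mk_surjective q
  rw [← QuotientAddGroup.mk_nsmul, QuotientAddGroup.eq_zero_iff, AddSubgroup.mem_addSubgroupOf]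
  show (m • x : periodLattice f).val ∈ periodLatticeGamma1 f
  simp only [AddSubgroupClass.coe_nsmul, nsmul_eq_mul]
  exact hm _ x.2

omit [NeZero N] in
/-- **`mΛ₀(f) ⊆ Λ₁(f) ⟺ exp(Λ₀(f)/Λ₁(f)) ∣ m`.** [cite: LingOesterle1991, §1] -/
theorem natMul_mem_iff_exponent_dvd (f : CuspForm (Gamma0 N) 2) (m : ℕ) :
    (∀ w ∈ periodLattice f, (m : ℂ) * w ∈ periodLatticeGamma1 f) ↔
      AddMonoid.exponent (periodLattice f ⧸ (periodLatticeGamma1 f).addSubgroupOf (periodLattice f)) ∣ m := by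
  refine ⟨exponent_dvd_of_natMul_mem f, fun ⟨k, hk⟩ w hw ↦ ?_⟩
  have h := exponent_mul_mem_periodLatticeGamma1 f hw
  have e : (m : ℂ) * w = (k : ℂ) *
      (((AddMonoid.exponent (periodLattice f ⧸ (periodLatticeGamma1 f).addSubgroupOf (periodLattice f)) : ℂ)) * w) := by
    rw [hk]; push_cast; ring
  rw [e, ← nsmul_eq_mul]
  exact nsmul_mem h k

/-- **`0 < exp(Λ₀(f)/Λ₁(f))`** (the quotient is finite, `relIndex_ne_zero`). [cite: LingOesterle1991, §1] -/
theorem shimuraExponent_pos (f : CuspForm (Gamma0 N) 2) :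
    0 < AddMonoid.exponent (periodLattice f ⧸ (periodLatticeGamma1 f).addSubgroupOf (periodLattice f)) := by
  have hidx : ((periodLatticeGamma1 f).addSubgroupOf (periodLattice f)).index ≠ 0 := by
    have h := relIndex_ne_zero f
    rwa [AddSubgroup.relIndex] at h
  haveI : Fintype (periodLattice f ⧸ (periodLatticeGamma1 f).addSubgroupOf (periodLattice f)) :=
    AddSubgroup.fintypeOfIndexNeZero hidx
  exact Nat.pos_of_ne_zero AddMonoid.exponent_ne_zero_of_finite

omit [NeZero N] in
/-- **`exp(Λ₀(f)/Λ₁(f)) ∣ [Λ₀(f) : Λ₁(f)]`** (Lagrange). [cite: LingOesterle1991, §1] -/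
theorem exponent_dvd_relIndex (f : CuspForm (Gamma0 N) 2) :
    AddMonoid.exponent (periodLattice f ⧸ (periodLatticeGamma1 f).addSubgroupOf (periodLattice f)) ∣
      (periodLatticeGamma1 f).relIndex (periodLattice f) := by
  rw [AddSubgroup.relIndex, AddSubgroup.index]
  exact AddGroup.exponent_dvd_nat_card

/-- **`[Λ₀(f) : Λ₁(f)] ∣ exp(Λ₀(f)/Λ₁(f))²`** for the newform of an `X₀(N)`-parametrised curve (`Λ₀(f)` has rank `≤ 2`; T-es-111's
square bound at `m = exp`): the exponent and the index have the same prime support. [cite: LingOesterle1991, §1] [cite: SilvermanAEC2009, Thm. VI.5.1] -/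
theorem relIndex_dvd_exponent_sq {W₀ : WeierstrassCurve ℚ} (D₀ : ModularParametrizationData W₀ N) :
    (periodLatticeGamma1 D₀.f).relIndex (periodLattice D₀.f) ∣
      AddMonoid.exponent (periodLattice D₀.f ⧸ (periodLatticeGamma1 D₀.f).addSubgroupOf (periodLattice D₀.f)) ^ 2 :=
  relIndex_dvd_sq_of_natMul_mem D₀ fun _ hw ↦ exponent_mul_mem_periodLatticeGamma1 D₀.f hw

/-- `p ∣ [Λ₀(f) : Λ₁(f)] ⟺ p ∣ exp(Λ₀(f)/Λ₁(f))` for primes `p` (newform of an `X₀(N)`-parametrised curve). [cite: LingOesterle1991, §1] -/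
theorem prime_dvd_relIndex_iff_dvd_exponent {W₀ : WeierstrassCurve ℚ} (D₀ : ModularParametrizationData W₀ N) {p : ℕ} (hp : p.Prime) :
    p ∣ (periodLatticeGamma1 D₀.f).relIndex (periodLattice D₀.f) ↔
      p ∣ AddMonoid.exponent (periodLattice D₀.f ⧸ (periodLatticeGamma1 D₀.f).addSubgroupOf (periodLattice D₀.f)) :=
  ⟨fun h ↦ hp.dvd_of_dvd_pow (h.trans (relIndex_dvd_exponent_sq D₀)), fun h ↦ h.trans (exponent_dvd_relIndex D₀.f)⟩

/-! ## §2 The `X₀(N)`-multipliers of Stevens' curve -/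

/-- **`exp(Λ₀(f)/Λ₁(f)) · c₁` is an `X₀(N)`-multiplier** of any model carrying an `X₁(N)`-datum `D₁`: `(exp·c₁)·Λ₀(f) ⊆ Λ_W`
(no optimality needed). [cite: Stevens1989, §2] [cite: CesnaviciusNeururerSaha2023, §1] -/
theorem exponent_mul_maninConstant₁_mul_mem_lattice {W : WeierstrassCurve ℚ} (D₁ : Gamma1ParametrizationData W N)
    {w : ℂ} (hw : w ∈ periodLattice D₁.f) :
    (((AddMonoid.exponent (periodLattice D₁.f ⧸ (periodLatticeGamma1 D₁.f).addSubgroupOf (periodLattice D₁.f)) : ℤ) *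
        D₁.maninConstant : ℤ) : ℂ) * w ∈ D₁.L.lattice := by
  have h := D₁.smul_periodLatticeGamma1_le _ (exponent_mul_mem_periodLatticeGamma1 D₁.f hw)
  have e : (((AddMonoid.exponent (periodLattice D₁.f ⧸ (periodLatticeGamma1 D₁.f).addSubgroupOf (periodLattice D₁.f)) : ℤ) *
        D₁.maninConstant : ℤ) : ℂ) * w = (D₁.c : ℂ) *
      (((AddMonoid.exponent (periodLattice D₁.f ⧸ (periodLatticeGamma1 D₁.f).addSubgroupOf (periodLattice D₁.f)) : ℂ)) * w) := by
    push_cast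
    simp only [Gamma1ParametrizationData.maninConstant]
    ring
  rw [e]; exact h

/-- A multiple of a multiplier is a multiplier: `exp ∣ m` ⟹ `(m c₁)·Λ₀(f) ⊆ Λ_W`. [cite: Stevens1989, §2] -/
theorem mul_maninConstant₁_mul_mem_lattice_of_exponent_dvd {W : WeierstrassCurve ℚ} (D₁ : Gamma1ParametrizationData W N) {m : ℤ}
    (hm : ((AddMonoid.exponent (periodLattice D₁.f ⧸ (periodLatticeGamma1 D₁.f).addSubgroupOf (periodLattice D₁.f)) : ℤ)) ∣ m)
    {w : ℂ} (hw : w ∈ periodLattice D₁.f) : ((m * D₁.maninConstant : ℤ) : ℂ) * w ∈ D₁.L.lattice := by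
  obtain ⟨k, rfl⟩ := hm
  have h := exponent_mul_maninConstant₁_mul_mem_lattice D₁ hw
  have e : ((((AddMonoid.exponent (periodLattice D₁.f ⧸ (periodLatticeGamma1 D₁.f).addSubgroupOf (periodLattice D₁.f)) : ℤ)) * k *
        D₁.maninConstant : ℤ) : ℂ) * w = (k : ℂ) *
      ((((AddMonoid.exponent (periodLattice D₁.f ⧸ (periodLatticeGamma1 D₁.f).addSubgroupOf (periodLattice D₁.f)) : ℤ) *
        D₁.maninConstant : ℤ) : ℂ) * w) := by
    push_cast; ring
  rw [e, ← zsmul_eq_mul]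
  exact zsmul_mem h k

/-- **Optimal `X₁(N)`-datum: `(m c₁)·Λ₀(f) ⊆ Λ_{E₁}` ⟹ `exp(Λ₀(f)/Λ₁(f)) ∣ m`** — on Stevens' curve `Λ_{E₁} = c₁Λ₁(f)`, so `mΛ₀(f) ⊆ Λ₁(f)`.
[cite: Stevens1989, §2] [cite: LingOesterle1991, §1] -/
theorem exponent_dvd_of_mul_maninConstant₁_mul_mem_lattice {W : WeierstrassCurve ℚ} (D₁ : Gamma1ParametrizationData W N)
    (h₁ : D₁.IsOptimal) {m : ℤ} (hm : ∀ w ∈ periodLattice D₁.f, ((m * D₁.maninConstant : ℤ) : ℂ) * w ∈ D₁.L.lattice) :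
    ((AddMonoid.exponent (periodLattice D₁.f ⧸ (periodLatticeGamma1 D₁.f).addSubgroupOf (periodLattice D₁.f)) : ℤ)) ∣ m := by
  have hc₁ : (D₁.c : ℂ) ≠ 0 := by exact_mod_cast D₁.maninConstant_ne_zero
  have hmem : ∀ w ∈ periodLattice D₁.f, (m : ℂ) * w ∈ periodLatticeGamma1 D₁.f := fun w hw ↦ by
    obtain ⟨w', hw', e⟩ := h₁ _ (hm w hw)
    have e' : (D₁.c : ℂ) * ((m : ℂ) * w) = (D₁.c : ℂ) * w' := by
      rw [← e]; push_cast; simp only [Gamma1ParametrizationData.maninConstant]; ring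
    rw [mul_left_cancel₀ hc₁ e']; exact hw'
  exact Int.natCast_dvd.mpr (exponent_dvd_of_natMul_mem D₁.f fun w hw ↦ natAbs_mul_mem_gamma1_aux D₁.f (hmem w hw))

/-- **THE MULTIPLIER SET OF STEVENS' CURVE: `(m c₁)·Λ₀(f) ⊆ Λ_{E₁} ⟺ exp(Λ₀(f)/Λ₁(f)) ∣ m`** for an optimal `X₁(N)`-datum (no facts).
With `|c₁| = 1`: the integers `c` with `cΛ₀(f) ⊆ Λ_{E₁}` — the possible `X₀(N)`-Manin constants of Stevens' curve — are exactly the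
multiples of the exponent of the Shimura quotient. [cite: Stevens1989, §2] [cite: LingOesterle1991, §1] [cite: CesnaviciusNeururerSaha2023, Lemma 6.5] -/
theorem mul_maninConstant₁_mul_mem_lattice_iff_exponent_dvd {W : WeierstrassCurve ℚ} (D₁ : Gamma1ParametrizationData W N)
    (h₁ : D₁.IsOptimal) (m : ℤ) :
    (∀ w ∈ periodLattice D₁.f, ((m * D₁.maninConstant : ℤ) : ℂ) * w ∈ D₁.L.lattice) ↔
      ((AddMonoid.exponent (periodLattice D₁.f ⧸ (periodLatticeGamma1 D₁.f).addSubgroupOf (periodLattice D₁.f)) : ℤ)) ∣ m :=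
  ⟨exponent_dvd_of_mul_maninConstant₁_mul_mem_lattice D₁ h₁, fun hm _ hw ↦ mul_maninConstant₁_mul_mem_lattice_of_exponent_dvd D₁ hm hw⟩

/-- **The exponent is the LEAST positive multiplier**: `exp(Λ₀(f)/Λ₁(f))` is the least `m > 0` with `(m c₁)·Λ₀(f) ⊆ Λ_{E₁}` for an optimal
`X₁(N)`-datum — «Cremona's `X₀(N)`-constant of Stevens' curve is the exponent of the Shimura quotient» (with `|c₁| = 1`).
[cite: Stevens1989, §2] [cite: Cremona1997, §2.10] [cite: LingOesterle1991, §1] -/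
theorem isLeast_exponent_mul_maninConstant₁ {W : WeierstrassCurve ℚ} (D₁ : Gamma1ParametrizationData W N) (h₁ : D₁.IsOptimal) :
    IsLeast {m : ℕ | 0 < m ∧ ∀ w ∈ periodLattice D₁.f, ((m * D₁.maninConstant : ℤ) : ℂ) * w ∈ D₁.L.lattice}
      (AddMonoid.exponent (periodLattice D₁.f ⧸ (periodLatticeGamma1 D₁.f).addSubgroupOf (periodLattice D₁.f))) := by
  refine ⟨⟨shimuraExponent_pos D₁.f, fun w hw ↦ ?_⟩, fun m ⟨hm0, hm⟩ ↦ ?_⟩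
  · exact mul_maninConstant₁_mul_mem_lattice_of_exponent_dvd D₁ (dvd_refl _) hw
  · exact Nat.le_of_dvd hm0 (Int.natCast_dvd_natCast.mp (exponent_dvd_of_mul_maninConstant₁_mul_mem_lattice D₁ h₁ hm))

/-- **Index form at a prime: `p ∣ [Λ₀(f) : Λ₁(f)]` ⟹ `p` divides every multiplier** — if `(m c₁)·Λ₀(f) ⊆ Λ_{E₁}` then `p ∣ m`
(newform of the optimal `X₁(N)`-datum's curve, which is `X₀(N)`-parametrised through `X₁(N) → X₀(N)`: the rank-`2` square bound is taken from
an auxiliary `X₀(N)`-datum `D₀` with the same newform). [cite: LingOesterle1991, §1] [cite: Stevens1989, §2] -/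
theorem prime_dvd_of_mul_maninConstant₁_mul_mem_lattice {W W₀ : WeierstrassCurve ℚ} (D₁ : Gamma1ParametrizationData W N)
    (h₁ : D₁.IsOptimal) (D₀ : ModularParametrizationData W₀ N) (hf : D₁.f = D₀.f) {p : ℕ} (hp : p.Prime)
    (hpi : p ∣ (periodLatticeGamma1 D₀.f).relIndex (periodLattice D₀.f)) {m : ℤ}
    (hm : ∀ w ∈ periodLattice D₁.f, ((m * D₁.maninConstant : ℤ) : ℂ) * w ∈ D₁.L.lattice) : (p : ℤ) ∣ m := by
  have hpe := (prime_dvd_relIndex_iff_dvd_exponent D₀ hp).mp hpi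
  rw [← hf] at hpe
  exact (Int.natCast_dvd_natCast.mpr hpe).trans (exponent_dvd_of_mul_maninConstant₁_mul_mem_lattice D₁ h₁ hm)

end StevensMultipliers

end Summit.BirchSwinnertonDyer.BirchSwinnertonDyer.Theorems.ManinLocalTwoThree.ShimuraIndex
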